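import Mathlib.MeasureTheory.Integral.DominatedConvergence
import Mathlib.MeasureTheory.Integral.IntervalIntegral.Basic
import Mathlib.MeasureTheory.Function.Floor
import Mathlib.Topology.Instances.Matrix
import Literature.Probability.LatticeModels.IsingRowDeterminant
import HarnessLib

/-!
# The outer limit `N → ∞` of the Ising cylinder row correlations: BGJS (3.3) discharged

Topic `Probability/LatticeModels`, namespace `Literature.Probability.LatticeModels`. Sibling proof
file of `IsingTorusTransfer.lean`, discharging its named fact

* `tendsto_torusRowPair_outer_exists` (G. Benettin, G. Gallavotti, G. Jona-Lasinio, A. L. Stella,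
  *On the Onsager–Yang value of the spontaneous magnetization*, Comm. Math. Phys. **30** (1973)
  45–54, §3 b), eq. (3.3): "`(σ_xσ_y)_p = lim_{N→∞} lim_{M→∞} ⟨σ_xσ_y⟩_{p,NM}` exists", for `x, y`
  on a row, "from the exact solution of the Ising model [3]" = E. W. Montroll, R. B. Potts,
  J. C. Ward, J. Math. Phys. 4 (1963) 308; T. D. Schultz, D. C. Mattis, E. H. Lieb, Rev. Mod.
  Phys. 36 (1964) 856, §V): for `β ≥ 0` and every `k`, the outer limit `N → ∞` of the inner limits
  `lim_M ⟨σ_{(0,0)}σ_{(k,0)}⟩_{p,NM}` exists.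

## The proof (Schultz–Mattis–Lieb 1964, §V, "in the limit `N → ∞` the sums become integrals")

The tree's exact-solution programme (`IsingTransferOperator`, `IsingMajorana`, `IsingKaufman`,
`IsingKaufmanBlocks`, `IsingPolarization`, `IsingTopVacuum`, `IsingCylinderState`,
`IsingRowDeterminant`) ends with the PROVED determinant formula
`IsingRowDeterminant.limUnder_torusRowPair_eq_det`: for `β > 0`, `N = m + 3 > k`,

  `lim_{M→∞} ⟨σ_{(0,0)}σ_{(k,0)}⟩_{p,NM} = i^k det (G_N(i, j+1))_{i,j<k}`,

  `G_N(i,j) = N⁻¹ ∑_{m<N} e^{-iq_m i} e^{iq_m j} γ_{q_m}/sh_{q_m}`,  `q_m = (2m+1)π/N`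

(SML 1964, §V, eqs. (5.3)–(5.7)). The entries `G_N(i,j)` are midpoint Riemann sums, over the
uniform partition of `[0, 2π]` into `N` cells, of the function
`F_{ij}(q) = e^{-iqi} e^{iqj} γ_q/sh_q`, which is continuous on the OPEN interval `(0, 2π)`
(`sh_q > 0` there for `β > 0`, `IsingKaufmanBlocks.one_lt_chQ`) and bounded by `1` in modulus
(`|γ_q|² = sh_q²`). At `β = β_c(2)` it is NOT continuous on the closed circle (`sh_0 = 0`; this
is the jump of Onsager's symbol at `T_c`, Deift–Its–Krasovsky 2013, eq. (25)), so we prove the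
Riemann-sum convergence in the generality "bounded and continuous on the open interval"
(`tendsto_riemannSum_midpoint`: the midpoint sums are the integrals of step functions which
converge pointwise on `(0, 2π)`, dominated convergence). Hence every entry converges
(`tendsto_cylKernel`), the determinant converges by continuity (`exists_tendsto_det_cylKernel`), and
the real sequence of inner limits, being eventually the real part of `i^k det G_N`, converges
(`exists_tendsto_torusRowPair_outer_of_pos`). At `β = 0` the spins are independent and the sandwich
`OnsagerYang.isingCorr_free_box_le_torusRowPair` / `torusRowPair_le_isingCorr_plus_box` pins
`⟨σ_{(0,0)}σ_{(k,0)}⟩_{p,NM}` to a constant for `N, M ≥ 2k + 3` (`torusRowPair_zero_beta`).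

No definitions and no named facts are introduced (the step functions, cell midpoints
`(2m+1)π/N` and cell indices `⌊qN/2π⌋` are written out); the discharge is
`tendsto_torusRowPair_outer_exists_holds`, and `tendsto_torusRowPair_exists_holds` (BGJS (3.3) in
full, inner AND outer limits) follows by `IsingTorusTransfer.tendsto_torusRowPair_exists_of_outer`.

## Mathlib anchors

`MeasureTheory.tendsto_integral_of_dominated_convergence`,
`intervalIntegral.sum_integral_adjacent_intervals`, `MeasureTheory.integral_Ioc_eq_integral_Ioo`,
`MeasureTheory.setIntegral_congr_fun`, `MeasureTheory.setIntegral_const`, `Real.volume_real_Ioo_of_le`,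
`Nat.measurable_floor`, `measurable_from_nat`, `Nat.floor_eq_iff`, `Continuous.matrix_det`,
`tendsto_pi_nhds`, `Filter.tendsto_add_atTop_iff_nat`.

## References

* G. Benettin, G. Gallavotti, G. Jona-Lasinio, A. L. Stella, Comm. Math. Phys. 30 (1973) 45–54, §3 b).
* T. D. Schultz, D. C. Mattis, E. H. Lieb, Rev. Mod. Phys. 36 (1964) 856–871, §V.
* E. W. Montroll, R. B. Potts, J. C. Ward, J. Math. Phys. 4 (1963) 308–322.
* P. Deift, A. Its, I. Krasovsky, Comm. Pure Appl. Math. 66 (2013) 1360–1438, §2, eq. (25).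
-/

noncomputable section

open MeasureTheory Filter Topology Complex Finset Set
open Literature.Probability.LatticeModels

namespace Literature.Probability.LatticeModels

/-! ### Midpoint Riemann sums of bounded functions continuous on the open interval `(0, 2π)` -/

section Riemann

/-- Midpoints `(2m+1)π/N`, `m < N`, of the cells of the uniform partition of `[0, 2π]` lie in the
open interval `(0, 2π)` (they are the antiperiodic momenta `apMom N m`). [folklore] -/
theorem midpoint_mem_Ioo {N m : ℕ} (hm : m < N) : (2 * (m : ℝ) + 1) * Real.pi / N ∈ Ioo 0 (2 * Real.pi) := by
  have hN : (0 : ℝ) < N := by exact_mod_cast lt_of_le_of_lt (Nat.zero_le m) hm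
  refine ⟨by positivity, ?_⟩
  rw [div_lt_iff₀ hN]
  have h : (2 * (m : ℝ) + 1) < 2 * N := by exact_mod_cast (by omega : 2 * m + 1 < 2 * N)
  nlinarith [Real.pi_pos]

/-- A point of `(0, 2π)` lies in one of the `N` cells: its cell index `⌊qN/2π⌋` is `< N`. [folklore] -/
theorem floor_cell_lt {N : ℕ} (hN : 0 < N) {q : ℝ} (hq : q ∈ Ioo 0 (2 * Real.pi)) :
    ⌊q * N / (2 * Real.pi)⌋₊ < N := by
  have hN' : (0 : ℝ) < N := by exact_mod_cast hN
  have hq0 : 0 ≤ q * N / (2 * Real.pi) := by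
    have := hq.1.le
    positivity
  rw [Nat.floor_lt hq0, div_lt_iff₀ (by positivity)]
  nlinarith [hq.2]

/-- The midpoint of the cell of `q ≥ 0` is within `π/N` of `q`. [folklore] -/
theorem abs_midpoint_floor_sub_le {N : ℕ} (hN : 0 < N) {q : ℝ} (hq : 0 ≤ q) :
    |(2 * ((⌊q * N / (2 * Real.pi)⌋₊ : ℕ) : ℝ) + 1) * Real.pi / N - q| ≤ Real.pi / N := by
  have hN' : (0 : ℝ) < N := by exact_mod_cast hN
  set x : ℝ := q * N / (2 * Real.pi) with hx
  have hx0 : 0 ≤ x := by positivity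
  have h1 : ((⌊x⌋₊ : ℕ) : ℝ) ≤ x := Nat.floor_le hx0
  have h2 : x < ((⌊x⌋₊ : ℕ) : ℝ) + 1 := Nat.lt_floor_add_one x
  have hq' : q = 2 * Real.pi * x / N := by
    rw [hx]
    field_simp
  have key : (2 * ((⌊x⌋₊ : ℕ) : ℝ) + 1) * Real.pi / N - q = Real.pi / N * (2 * ((⌊x⌋₊ : ℕ) : ℝ) + 1 - 2 * x) := by
    rw [hq']
    field_simp
  rw [key, abs_mul, abs_of_pos (div_pos Real.pi_pos hN')]
  calc Real.pi / N * |2 * ((⌊x⌋₊ : ℕ) : ℝ) + 1 - 2 * x|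
      ≤ Real.pi / N * 1 := by
        gcongr
        rw [abs_le]
        constructor <;> linarith
    _ = Real.pi / N := mul_one _

/-- On the open `m`-th cell the cell index is `m`. [folklore] -/
theorem floor_cell_eq_of_mem_Ioo {N : ℕ} (hN : 0 < N) {m : ℕ} {q : ℝ}
    (hq : q ∈ Ioo (2 * Real.pi * m / N) (2 * Real.pi * (m + 1) / N)) : ⌊q * N / (2 * Real.pi)⌋₊ = m := by
  have hN' : (0 : ℝ) < N := by exact_mod_cast hN
  have hπ : 0 < 2 * Real.pi := by positivity
  obtain ⟨h1, h2⟩ := hq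
  rw [div_lt_iff₀ hN'] at h1
  rw [lt_div_iff₀ hN'] at h2
  have hm0 : (0 : ℝ) ≤ 2 * Real.pi * m := by positivity
  have hq0 : 0 ≤ q * N / (2 * Real.pi) := div_nonneg (by nlinarith) hπ.le
  rw [Nat.floor_eq_iff hq0]
  constructor
  · rw [le_div_iff₀ hπ]
    linarith
  · rw [div_lt_iff₀ hπ]
    linarith

/-- The midpoint step function `q ↦ F((2⌊qN/2π⌋+1)π/N)` is measurable (a function of
`⌊qN/2π⌋`). [folklore] -/
theorem measurable_midStep (F : ℝ → ℂ) (N : ℕ) :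
    Measurable fun q : ℝ => F ((2 * ((⌊q * N / (2 * Real.pi)⌋₊ : ℕ) : ℝ) + 1) * Real.pi / N) := by
  have h1 : Measurable fun q : ℝ => ⌊q * N / (2 * Real.pi)⌋₊ :=
    Nat.measurable_floor.comp ((measurable_id.mul_const _).div_const _)
  exact (measurable_from_nat (f := fun m : ℕ => F ((2 * (m : ℝ) + 1) * Real.pi / N))).comp h1

/-- **The midpoint Riemann sum is the integral of the step function**:
`∫_{(0,2π)} S_N F = ∑_{m<N} (2π/N) F((2m+1)π/N)`. [folklore] -/
theorem integral_midStep (F : ℝ → ℂ) {N : ℕ} (hN : 0 < N) :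
    ∫ q in Ioo 0 (2 * Real.pi), F ((2 * ((⌊q * N / (2 * Real.pi)⌋₊ : ℕ) : ℝ) + 1) * Real.pi / N) =
      ∑ m : Fin N, ((2 * Real.pi / N : ℝ) : ℂ) * F ((2 * ((m : ℕ) : ℝ) + 1) * Real.pi / N) := by
  have hN' : (0 : ℝ) < N := by exact_mod_cast hN
  set S : ℝ → ℂ := fun q => F ((2 * ((⌊q * N / (2 * Real.pi)⌋₊ : ℕ) : ℝ) + 1) * Real.pi / N) with hS
  set a : ℕ → ℝ := fun k => 2 * Real.pi * k / N with ha
  have ha_le : ∀ k : ℕ, a k ≤ a (k + 1) := fun k => by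
    simp only [ha]
    push_cast
    gcongr
    linarith
  have heq : ∀ k : ℕ, EqOn S (fun _ => F ((2 * (k : ℝ) + 1) * Real.pi / N)) (Ioo (a k) (a (k + 1))) := by
    intro k x hx
    simp only [hS]
    rw [floor_cell_eq_of_mem_Ioo hN (m := k) (by simpa [ha] using hx)]
  have hpiece : ∀ k : ℕ, ∫ x in a k..a (k + 1), S x =
      ((2 * Real.pi / N : ℝ) : ℂ) * F ((2 * (k : ℝ) + 1) * Real.pi / N) := by
    intro k
    rw [intervalIntegral.integral_of_le (ha_le k), integral_Ioc_eq_integral_Ioo,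
      setIntegral_congr_fun measurableSet_Ioo (heq k), setIntegral_const,
      Real.volume_real_Ioo_of_le (ha_le k), Complex.real_smul]
    congr 1
    simp only [ha]
    push_cast
    ring
  have hint : ∀ k < N, IntervalIntegrable S volume (a k) (a (k + 1)) := by
    intro k _
    rw [intervalIntegrable_iff_integrableOn_Ioc_of_le (ha_le k), integrableOn_Ioc_iff_integrableOn_Ioo]
    exact (integrableOn_const (hs := measure_Ioo_lt_top.ne)).congr_fun (heq k).symm measurableSet_Ioo
  have hadj := intervalIntegral.sum_integral_adjacent_intervals hint
  have ha0 : a 0 = 0 := by simp [ha]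
  have haN : a N = 2 * Real.pi := by
    simp only [ha]
    field_simp
  rw [ha0, haN, intervalIntegral.integral_of_le (by positivity), integral_Ioc_eq_integral_Ioo] at hadj
  rw [← hadj, Finset.sum_range]
  exact Finset.sum_congr rfl fun k _ => hpiece k

/-- **Dominated convergence for the midpoint step functions**: for `F` continuous on `(0, 2π)`
and bounded there, `∫_{(0,2π)} S_{N+1} F → ∫_{(0,2π)} F`. [folklore] -/
theorem tendsto_integral_midStep {F : ℝ → ℂ} {B : ℝ} (hF : ContinuousOn F (Ioo 0 (2 * Real.pi)))
    (hB : ∀ q ∈ Ioo 0 (2 * Real.pi), ‖F q‖ ≤ B) :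
    Tendsto (fun N : ℕ => ∫ q in Ioo 0 (2 * Real.pi),
        F ((2 * ((⌊q * (N + 1 : ℕ) / (2 * Real.pi)⌋₊ : ℕ) : ℝ) + 1) * Real.pi / (N + 1 : ℕ))) atTop
      (𝓝 (∫ q in Ioo 0 (2 * Real.pi), F q)) := by
  refine tendsto_integral_of_dominated_convergence (fun _ => B)
    (fun N => (measurable_midStep F (N + 1)).aestronglyMeasurable)
    (integrableOn_const (hs := measure_Ioo_lt_top.ne)) ?_ ?_
  · intro N
    refine ae_restrict_of_forall_mem measurableSet_Ioo fun q hq => ?_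
    exact hB _ (midpoint_mem_Ioo (floor_cell_lt (Nat.succ_pos N) hq))
  · refine ae_restrict_of_forall_mem measurableSet_Ioo fun q hq => ?_
    have hcont : ContinuousAt F q := hF.continuousAt (Ioo_mem_nhds hq.1 hq.2)
    refine hcont.tendsto.comp ?_
    have h0 : Tendsto (fun N : ℕ => Real.pi / ((N + 1 : ℕ) : ℝ)) atTop (𝓝 0) :=
      (tendsto_const_div_atTop_nhds_zero_nat Real.pi).comp (tendsto_add_atTop_nat 1)
    rw [tendsto_iff_norm_sub_tendsto_zero]
    refine squeeze_zero (fun N => norm_nonneg _) (fun N => ?_) h0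
    rw [Real.norm_eq_abs]
    exact abs_midpoint_floor_sub_le (Nat.succ_pos N) hq.1.le

/-- **Midpoint Riemann sums converge** for a function continuous on the open interval `(0, 2π)`
and bounded there: `N⁻¹ ∑_{m<N} F((2m+1)π/N) → (2π)⁻¹ ∫_{(0,2π)} F` (Schultz–Mattis–Lieb 1964,
§V: "in the limit `N → ∞` the sums over `q` become integrals"). [folklore] -/
theorem tendsto_riemannSum_midpoint {F : ℝ → ℂ} {B : ℝ} (hF : ContinuousOn F (Ioo 0 (2 * Real.pi)))
    (hB : ∀ q ∈ Ioo 0 (2 * Real.pi), ‖F q‖ ≤ B) :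
    Tendsto (fun N : ℕ => (N : ℂ)⁻¹ * ∑ m : Fin N, F ((2 * (m : ℕ) + 1) * Real.pi / N)) atTop
      (𝓝 ((2 * Real.pi : ℂ)⁻¹ * ∫ q in Ioo 0 (2 * Real.pi), F q)) := by
  rw [← tendsto_add_atTop_iff_nat 1]
  have h := (tendsto_integral_midStep hF hB).const_mul ((2 * Real.pi : ℂ)⁻¹)
  refine h.congr fun N => ?_
  rw [integral_midStep F (Nat.succ_pos N), Finset.mul_sum, Finset.mul_sum]
  refine Finset.sum_congr rfl fun m _ => ?_
  have hπ : (2 * Real.pi : ℂ) ≠ 0 := by exact_mod_cast (by positivity : (2 * Real.pi : ℝ) ≠ 0)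
  have hN : ((N + 1 : ℕ) : ℂ) ≠ 0 := by exact_mod_cast Nat.succ_ne_zero N
  push_cast
  field_simp

end Riemann

/-! ### The entries of the determinant: Riemann sums of a bounded function continuous on `(0, 2π)` -/

section Kernel

variable {β : ℝ}

/-- `q ↦ e^{iqj}` is continuous. [folklore] -/
theorem continuous_ph (j : ℕ) : Continuous fun q : ℝ => ph q j := by
  unfold ph
  fun_prop

/-- `q ↦ γ_q` is continuous. [folklore] -/
theorem continuous_gamQ (β : ℝ) : Continuous fun q : ℝ => gamQ β q := by
  unfold gamQ
  fun_prop

/-- `q ↦ ch_q` is continuous. [folklore] -/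
theorem continuous_chQ (β : ℝ) : Continuous fun q : ℝ => chQ β q := by
  unfold chQ
  fun_prop

/-- `q ↦ sh_q` is continuous. [folklore] -/
theorem continuous_shQ (β : ℝ) : Continuous fun q : ℝ => shQ β q := by
  unfold shQ
  exact Real.continuous_sqrt.comp (((continuous_chQ β).pow 2).sub continuous_const)

/-- `cos q < 1` on the open interval `(0, 2π)`. [folklore] -/
theorem cos_lt_one_of_mem_Ioo {q : ℝ} (hq : q ∈ Ioo 0 (2 * Real.pi)) : Real.cos q < 1 :=
  lt_of_le_of_ne (Real.cos_le_one _) fun h =>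
    absurd ((Real.cos_eq_one_iff_of_lt_of_lt (by linarith [hq.1, Real.pi_pos]) hq.2).1 h) hq.1.ne'

/-- `sh_q > 0` on `(0, 2π)` for `β > 0` (`ch_q > 1` off `q ≡ 0`). [folklore] -/
theorem shQ_pos_of_mem_Ioo (hβ : 0 < β) {q : ℝ} (hq : q ∈ Ioo 0 (2 * Real.pi)) : 0 < shQ β q :=
  shQ_pos (one_lt_chQ hβ (cos_lt_one_of_mem_Ioo hq))

/-- The integrand `F_{ij}(q) = e^{-iqi} e^{iqj} γ_q/sh_q` of the finite-`N` contraction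
`G_N(i,j) = N⁻¹ ∑_m F_{ij}(q_m)` (`IsingRowDeterminant.cylKernel`) is continuous on the open
interval `(0, 2π)` (but, at `β = β_c(2)`, not on the closed circle: `sh_0 = 0` there). [folklore] -/
theorem continuousOn_cylIntegrand (hβ : 0 < β) (i j : ℕ) :
    ContinuousOn (fun q : ℝ => starRingEnd ℂ (ph q i) * ph q j * (gamQ β q / ((shQ β q : ℝ) : ℂ)))
      (Ioo 0 (2 * Real.pi)) := by
  refine ((Complex.continuous_conj.comp (continuous_ph i)).mul (continuous_ph j)).continuousOn.mul ?_
  refine (continuous_gamQ β).continuousOn.div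
    (Complex.continuous_ofReal.comp (continuous_shQ β)).continuousOn fun q hq => ?_
  exact Complex.ofReal_ne_zero.2 (shQ_pos_of_mem_Ioo hβ hq).ne'

/-- `|e^{iqj}| = 1`. [folklore] -/
theorem norm_ph (q : ℝ) (j : ℕ) : ‖ph q j‖ = 1 := by
  rw [ph, show (q : ℂ) * (j : ℂ) * I = ((q * j : ℝ) : ℂ) * I by push_cast; ring,
    Complex.norm_exp_ofReal_mul_I]

/-- `|γ_q/sh_q| = 1` on `(0, 2π)` for `β > 0` (`|γ_q|² = ch_q² − 1 = sh_q²`). [folklore] -/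
theorem norm_gamQ_div_shQ (hβ : 0 < β) {q : ℝ} (hq : q ∈ Ioo 0 (2 * Real.pi)) :
    ‖gamQ β q / ((shQ β q : ℝ) : ℂ)‖ = 1 := by
  have hsh := shQ_pos_of_mem_Ioo hβ hq
  have h1 : 1 < chQ β q := one_lt_chQ hβ (cos_lt_one_of_mem_Ioo hq)
  have hg : ‖gamQ β q‖ = shQ β q := by
    have h2 : ‖gamQ β q‖ ^ 2 = shQ β q ^ 2 := by
      rw [Complex.sq_norm, normSq_gamQ, shQ_sq h1.le]
    exact (pow_left_inj₀ (norm_nonneg _) hsh.le two_ne_zero).1 h2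
  rw [norm_div, hg, Complex.norm_real, Real.norm_eq_abs, abs_of_pos hsh, div_self hsh.ne']

/-- The integrand is bounded by `1` on `(0, 2π)`. [folklore] -/
theorem norm_cylIntegrand_le (hβ : 0 < β) (i j : ℕ) {q : ℝ} (hq : q ∈ Ioo 0 (2 * Real.pi)) :
    ‖starRingEnd ℂ (ph q i) * ph q j * (gamQ β q / ((shQ β q : ℝ) : ℂ))‖ ≤ 1 := by
  rw [norm_mul, norm_mul, Complex.norm_conj, norm_ph, norm_ph, norm_gamQ_div_shQ hβ hq]
  norm_num

/-- **The contractions converge**: `G_N(i,j) → G(i,j) = (2π)⁻¹ ∫_0^{2π} e^{iq(j-i)} γ_q/sh_q dq`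
as `N → ∞`, for `β > 0` (SML 1964, §V: the `N → ∞` form of the contractions). [cite: SchultzMattisLieb1964, §V, eqs. (5.3)–(5.7)] -/
theorem tendsto_cylKernel (hβ : 0 < β) (i j : ℕ) :
    Tendsto (fun N : ℕ => cylKernel N β i j) atTop
      (𝓝 ((2 * Real.pi : ℂ)⁻¹ * ∫ q in Ioo 0 (2 * Real.pi),
        starRingEnd ℂ (ph q i) * ph q j * (gamQ β q / ((shQ β q : ℝ) : ℂ)))) :=
  (tendsto_riemannSum_midpoint (continuousOn_cylIntegrand hβ i j)
    (fun _ hq => norm_cylIntegrand_le hβ i j hq)).congr fun _ => rfl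

/-- **The `k × k` determinants converge** (continuity of `det`). [folklore] -/
theorem exists_tendsto_det_cylKernel (hβ : 0 < β) (k : ℕ) :
    ∃ D : ℂ, Tendsto (fun N : ℕ => (Matrix.of fun i j : Fin k => cylKernel N β i (j + 1)).det) atTop (𝓝 D) := by
  set L : Matrix (Fin k) (Fin k) ℂ := Matrix.of fun i j : Fin k =>
    (2 * Real.pi : ℂ)⁻¹ * ∫ q in Ioo 0 (2 * Real.pi),
      starRingEnd ℂ (ph q i) * ph q ((j : ℕ) + 1) * (gamQ β q / ((shQ β q : ℝ) : ℂ)) with hL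
  have hM : Tendsto (fun N : ℕ => Matrix.of fun i j : Fin k => cylKernel N β i (j + 1)) atTop (𝓝 L) := by
    refine tendsto_pi_nhds.2 fun i => tendsto_pi_nhds.2 fun j => ?_
    exact tendsto_cylKernel hβ i (j + 1)
  exact ⟨L.det, ((continuous_id.matrix_det).tendsto _).comp hM⟩

end Kernel

/-! ### The outer limit -/

/-- **BGJS (3.3), outer layer, `β > 0`**: the inner limits `lim_M ⟨σ_{(0,0)}σ_{(k,0)}⟩_{p,NM}`
converge as `N → ∞` (to `Re (i^k det G(i, j+1))_{i,j<k}`; SML 1964, §V: the row correlation of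
the cylinder is `i^k det G_N`, and `G_N → G` entrywise). [cite: BenettinGallavottiJonaLasinioStella1973, §3 b), eq. (3.3)] -/
theorem exists_tendsto_torusRowPair_outer_of_pos {β : ℝ} (hβ : 0 < β) (k : ℕ) :
    ∃ ρ : ℝ, Tendsto (fun N : ℕ => limUnder atTop fun M : ℕ => torusRowPair β N M k) atTop (𝓝 ρ) := by
  obtain ⟨D, hD⟩ := exists_tendsto_det_cylKernel hβ k
  have hC : Tendsto (fun N : ℕ => ((limUnder atTop fun M : ℕ => torusRowPair β N M k : ℝ) : ℂ)) atTop
      (𝓝 (I ^ k * D)) := by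
    refine (hD.const_mul (I ^ k)).congr' ?_
    filter_upwards [eventually_ge_atTop (k + 3)] with N hN
    obtain ⟨m, rfl⟩ : ∃ m, N = m + 3 := ⟨N - 3, by omega⟩
    exact (limUnder_torusRowPair_eq_det hβ m k (by omega)).symm
  exact ⟨(I ^ k * D).re, ((Complex.continuous_re.tendsto _).comp hC).congr fun N => Complex.ofReal_re _⟩

/-- At `β = 0` the boundary condition is invisible: `⟨σ_A⟩⁺_{Λ;0,h} = ⟨σ_A⟩^∅_{Λ;0,h}` (all
Boltzmann weights are `1`, and the glued configurations coincide). [folklore] -/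
theorem isingCorr_plus_eq_free_of_beta_zero {V : Type*} [DecidableEq V] (G : SimpleGraph V)
    [G.LocallyFinite] (Λ : Finset V) (h : ℝ) (A : Finset V) :
    isingCorr G Λ 0 h .plus A = isingCorr G Λ 0 h .free A := by
  have hw : ∀ (bc : BoundaryCondition V) (τ : Λ → ℤˣ), isingWeight G Λ 0 h bc τ = 1 := by
    intro bc τ
    simp [isingWeight]
  unfold isingCorr
  rw [isingExpect_eq_sum_div G Λ h .plus 0 (measurable_spinProduct A),
    isingExpect_eq_sum_div G Λ h .free 0 (measurable_spinProduct A)]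
  simp only [isingPartitionFunction, hw, one_mul, glue_free_eq_glue_plus]

/-- **`β = 0`: the periodic pair function is pinned.** For `1 ≤ k` and `N, M ≥ 2k + 3`,
`⟨σ_{(0,0)}σ_{(k,0)}⟩_{p,NM}` at `β = 0` equals the free correlation of the box `B(k)` of `ℤ²`
(the GKS sandwich `⟨σσ⟩^∅_{B(k)} ≤ ⟨σσ⟩_{p,NM} ≤ ⟨σσ⟩⁺_{B(k)}` of `OnsagerYang`, whose two ends agree
at `β = 0`). [folklore] -/
theorem torusRowPair_zero_beta {N M k : ℕ} (hN : 2 * k + 3 ≤ N) (hM : 2 * k + 3 ≤ M) (hk : 1 ≤ k) :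
    torusRowPair 0 N M k = isingCorr (zdGraph 2) (box 2 k) 0 0 .free {0, ![(k : ℤ), 0]} := by
  refine le_antisymm ?_ (isingCorr_free_box_le_torusRowPair le_rfl hN hM hk le_rfl)
  have h := torusRowPair_le_isingCorr_plus_box (β := 0) le_rfl hN hM hk le_rfl
  rwa [isingCorr_plus_eq_free_of_beta_zero] at h

/-- **BGJS (3.3), outer layer, `β = 0`**: the inner limits are eventually constant in `N`. [folklore] -/
theorem exists_tendsto_torusRowPair_outer_zero_beta (k : ℕ) :
    ∃ ρ : ℝ, Tendsto (fun N : ℕ => limUnder atTop fun M : ℕ => torusRowPair 0 N M k) atTop (𝓝 ρ) := by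
  rcases Nat.eq_zero_or_pos k with rfl | hk
  · refine ⟨1, tendsto_const_nhds.congr' ?_⟩
    filter_upwards [eventually_gt_atTop 0] with N hN
    refine (Tendsto.limUnder_eq ?_).symm
    refine tendsto_const_nhds.congr' ?_
    filter_upwards [eventually_gt_atTop 0] with M hM
    exact (torusRowPair_zero hN hM).symm
  · refine ⟨isingCorr (zdGraph 2) (box 2 k) 0 0 .free {0, ![(k : ℤ), 0]}, tendsto_const_nhds.congr' ?_⟩
    filter_upwards [eventually_ge_atTop (2 * k + 3)] with N hN
    refine (Tendsto.limUnder_eq ?_).symm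
    refine tendsto_const_nhds.congr' ?_
    filter_upwards [eventually_ge_atTop (2 * k + 3)] with M hM
    exact (torusRowPair_zero_beta hN hM hk).symm

/-- **Discharge of `tendsto_torusRowPair_outer_exists`** (BGJS, CMP 30 (1973), §3 b), eq. (3.3),
outer layer: the limit `N → ∞` of the cylinder row correlations exists, for `β ≥ 0` and every
`k`; "from the exact solution" — SML 1964, §V). [cite: BenettinGallavottiJonaLasinioStella1973, §3 b), eq. (3.3)] -/
theorem tendsto_torusRowPair_outer_exists_holds : tendsto_torusRowPair_outer_exists := by
  intro β hβ k
  rcases hβ.eq_or_lt with rfl | hβpos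
  · exact exists_tendsto_torusRowPair_outer_zero_beta k
  · exact exists_tendsto_torusRowPair_outer_of_pos hβpos k

/-- **Discharge of `tendsto_torusRowPair_exists`** (BGJS, CMP 30 (1973), §3 b), eq. (3.3) in
full: the inner limits `M → ∞` exist by the transfer matrix, `IsingTorusTransfer`, and the outer
limit `N → ∞` by the present file). [cite: BenettinGallavottiJonaLasinioStella1973, §3 b), eq. (3.3)] -/
theorem tendsto_torusRowPair_exists_holds : tendsto_torusRowPair_exists :=
  tendsto_torusRowPair_exists_of_outer tendsto_torusRowPair_outer_exists_holds

end Literature.Probability.LatticeModels
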